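import Mathlib
import Literature.AlgebraicGeometry.Resolution.CobordantGame
import Literature.AlgebraicGeometry.Resolution.CobordantChartCoefficients
import Literature.AlgebraicGeometry.Resolution.CobordantChartPlaneSlice
import Literature.AlgebraicGeometry.Resolution.CobordantTupleGame
import Literature.AlgebraicGeometry.Resolution.CobordantArcLemma
import Literature.AlgebraicGeometry.Resolution.FormalCoordinateChange
import Summits.ResolutionOfSingularities.ResolutionOfSingularities.Theorems.WeightedInvariantGlobalizeLocalDropCanonize
import Summits.ResolutionOfSingularities.ResolutionOfSingularities.Theorems.WeightedInvariantGlobalizeLocalDropRegularGerms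
import Summits.ResolutionOfSingularities.ResolutionOfSingularities.Theorems.WeightedInvariantLocalWeightedDropConeDichotomy
import Summits.ResolutionOfSingularities.ResolutionOfSingularities.Theorems.WeightedInvariantLocalWeightedDropConeDichotomyAux
import Summits.ResolutionOfSingularities.ResolutionOfSingularities.Theorems.WeightedInvariantLocalWeightedDropTangentConeCut
import Summits.ResolutionOfSingularities.ResolutionOfSingularities.Theorems.WeightedInvariantLocalWeightedDropPlaneBranchDropOfCount
import Summits.ResolutionOfSingularities.ResolutionOfSingularities.Theorems.WeightedInvariantLocalWeightedDropMultiplicityLift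
import Summits.ResolutionOfSingularities.ResolutionOfSingularities.Theorems.WeightedInvariantLocalWeightedDropMonicPointBlowup
import Summits.ResolutionOfSingularities.ResolutionOfSingularities.Theorems.WeightedInvariantLocalWeightedDropMonicRecentre
import Summits.ResolutionOfSingularities.ResolutionOfSingularities.Theorems.WeightedInvariantLocalWeightedDropMonicDoublePointLift
import Summits.ResolutionOfSingularities.ResolutionOfSingularities.Theorems.WeightedInvariantLocalWeightedDropTerminalDoublePointsAux

/-!
# `WeightedInvariant.LocalWeightedDrop`, line `hasse-ridge-face-selection`: the INSEP point step with cleaning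
# (successor trichotomy for the purely inseparable char-`2` double points `y² + A₀(x₀,x₁)`)

Crux item stmt-ResolutionOfSingularities-8899 `LocalWeightedDrop` (route `ResolutionOfSingularities/WeightedInvariant`),
serving the door `WeightedConstruction` stmt-ResolutionOfSingularities-0571.  [OURS · L1 W4.3, chain w43, stub worker 3
(gen 2): work unit (u2) «the INSEP successor trichotomy» of CRUX-PLAN v2 §v2.3 for the REDUCTION piece S2iM
`stub_charTwoInseparableReductionWon` (class INSEP = `{y² + A₀}`, `A₀ mod squares`); NOT a statement of any manuscript.]

THE POINT STEP (`won_dp_of_pointStep`, every characteristic `p`).  For `y² + A₀(x₀,x₁)` with `ord A₀ > 2`, the landed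
brick `won_monic_of_pointBlowup` (point blow-up, weights `(1,1,1)`) wins as soon as every SINGULAR successor slice is won; here
the slices are made explicit: in the direction `c = (c₀, c₁)`, live slot `i₀` (`c_{i₀} ≠ 0`), the slice is `y² + A₀'` with
`A₀(π_{i₀,c}) = x₀² · A₀'`, where `π_{i₀,c} : x_{i₀} ↦ c_{i₀} x₀, x_l ↦ x₀ (c_l + x₁)` (`l ≠ i₀`) is the classical affine
chart of the point blow-up at the point `(c₀ : c₁)` of the exceptional line (`InsepDoublePoint.slice_subst_pointChart`: the
composite «cobordant chart `(1,1)` at `c`, then `TupleGame.slice i₀`» IS `π_{i₀,c}`).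

THE CLEANING (characteristic `2`, `k` algebraically closed; `won_dp_of_clean`).  A SINGULAR slice `y² + A'` has
`ord A' ≥ 2`; (i) if the cross coefficient `[x₀x₁] A' ≠ 0` the tangent quadric is not a square (in characteristic `2` the
square of a linear form has no cross terms), so `stub_coneDichotomy` hands a hyperbolic pair to
`TangentConeCut.hyperbolicStartsWon` — EXIT (`won_dp_of_crossTerm`); (ii) otherwise the quadratic part is
`a x₀² + b x₁² = (√a x₀ + √b x₁)²` and the re-centring `y ↦ y + √a x₀ + √b x₁` (`won_monic_two_recentre_iff`; in characteristic `2`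
`y² + A' ↦ y² + A' + φ²`, `won_dp_add_sq_iff`) returns to the class with `ord (A' + φ²) > 2` (`two_lt_order_clean`).

ASSEMBLY: `won_insep_of_pointStep` / `won_insep_of_curveStep` — `y² + A₀` is won as soon as every CLEANED same-class successor
`y² + (A' + (αx₀ + βx₁)²)` (`α² = [x₀²]A'`, `β² = [x₁²]A'`, order `> 2` again) of the point blow-up, resp. of the blow-up of
`V(x_i, y)` when `x_i² ∣ A₀` (`TerminalDoublePoint.won_dp_of_curveStep`), is won.  The descent (which cleaned successor is
smaller, Hauser–Wagner's height / bonus) is NOT here.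
-/

set_option linter.dupNamespace false -- mandated namespace of this single-conjunct summit

namespace Summit.ResolutionOfSingularities.ResolutionOfSingularities.Theorems

open Literature.AlgebraicGeometry.Resolution
open Literature.AlgebraicGeometry.Resolution.CobordantGame

namespace InsepDoublePoint

open MvPowerSeries

variable {k : Type} [Field k]

/-! ### The composite «point chart, then slice» is the classical affine blow-up chart -/

/-- The chart `π_{i₀,c}` has zero constant terms. -/
theorem constantCoeff_pi (i₀ : Fin 2) (c : Fin 2 → k) (l : Fin 2) :
    constantCoeff ((fun l : Fin 2 => if l = i₀ then C (c i₀) * X 0 else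
      X 0 * (C (c l) + (X 1 : MvPowerSeries (Fin 2) k))) l) = 0 := by
  dsimp only
  split_ifs <;> simp [constantCoeff_X]

/-- `π_{i₀,c}` is substitutable. -/
theorem hasSubst_pi (i₀ : Fin 2) (c : Fin 2 → k) :
    HasSubst (fun l : Fin 2 => if l = i₀ then C (c i₀) * X 0 else
      X 0 * (C (c l) + (X 1 : MvPowerSeries (Fin 2) k))) :=
  hasSubst_of_constantCoeff_zero (constantCoeff_pi i₀ c)

/-- THE COMPOSITE «blow up the origin (weights `(1,1)`), go to the exceptional point `c`, slice the live slot `x_{i₀}' ↦ 0`» on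
the old variables IS the classical affine chart `π_{i₀,c} : x_{i₀} ↦ c_{i₀} · x₀`, `x_l ↦ x₀ · (c_l + x₁)` (`l ≠ i₀`; the
exceptional variable `s` becomes `x₀`). -/
theorem slice_subst_pointChart (i₀ : Fin 2) (c : Fin 2 → k) (F : MvPowerSeries (Fin 2) k) :
    TupleGame.slice i₀ (subst (CobordantChart.chart (fun _ : Fin 2 => 1) c) F) =
      subst (fun l : Fin 2 => if l = i₀ then C (c i₀) * X 0 else
        X 0 * (C (c l) + (X 1 : MvPowerSeries (Fin 2) k))) F := by
  have hch := CobordantChart.hasSubst_chart (fun _ : Fin 2 => 1) c (fun l hl => absurd hl one_ne_zero)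
  have hsl := CobordantChartPlaneSlice.hasSubst_slice (R := k) (n := 2) i₀
  unfold TupleGame.slice
  rw [subst_comp_subst_apply hch hsl]
  congr 1
  funext l
  rw [CobordantChart.chart_apply, pow_one, subst_mul hsl, subst_add hsl, subst_C,
    PlaneBranchDropOfCount.subst_slice_X_zero]
  by_cases hl : l = i₀
  · subst hl
    rw [PlaneBranchDropOfCount.subst_slice_X_succ_self, add_zero, mul_comm, if_pos rfl]
  · rw [PlaneBranchDropOfCount.subst_slice_X_succ_of_ne hl, if_neg hl]

/-- The tuple-game slice of the zero series is zero. -/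
theorem slice_zero (i₀ : Fin 2) : TupleGame.slice i₀ (0 : MvPowerSeries (Fin 3) k) = 0 := by
  unfold TupleGame.slice
  rw [← coe_substAlgHom (CobordantChartPlaneSlice.hasSubst_slice (R := k) (n := 2) i₀), map_zero]

/-! ### The point step on `y² + A₀` -/

/-- THE POINT STEP (every characteristic).  If `ord A₀ > 2`, the point blow-up (`won_monic_of_pointBlowup`) wins `y² + A₀` as
soon as every SINGULAR slice `y² + A₀'`, `A₀(π_{i₀,c}) = x₀² · A₀'` (`c_{i₀} ≠ 0`), is won. -/
theorem won_dp_of_pointStep (p : ℕ) (hp : p.Prime) (k : Type) [Field k] [CharP k p]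
    (A₀ : MvPowerSeries (Fin 2) k) (hA₀ : (2 : ℕ∞) < A₀.order)
    (hsucc : ∀ (c : Fin 2 → k) (i₀ : Fin 2), c i₀ ≠ 0 → ∀ A₀' : MvPowerSeries (Fin 2) k,
      subst (fun l : Fin 2 => if l = i₀ then C (c i₀) * X 0 else
        X 0 * (C (c l) + (X 1 : MvPowerSeries (Fin 2) k))) A₀ = X 0 ^ 2 * A₀' →
      CobordantGame.IsSingular k (X (Fin.last 2) ^ 2 + rename (Fin.succAboveEmb (Fin.last 2)) A₀') →
      CobordantGame.Won k 3 (X (Fin.last 2) ^ 2 + rename (Fin.succAboveEmb (Fin.last 2)) A₀')) :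
    CobordantGame.Won k 3 (X (Fin.last 2) ^ 2 + rename (Fin.succAboveEmb (Fin.last 2)) A₀) := by
  classical
  have hform : X (Fin.last 2) ^ 2 + rename (Fin.succAboveEmb (Fin.last 2)) A₀ =
      X (Fin.last 2) ^ 2 + ∑ j : Fin 2, rename (Fin.succAboveEmb (Fin.last 2))
        ((![A₀, 0] : Fin 2 → MvPowerSeries (Fin 2) k) j) * X (Fin.last 2) ^ (j : ℕ) := by
    rw [← MonicDoublePointLift.monic_two_eq_sum A₀ 0, map_zero, zero_mul, add_zero]
  rw [hform]
  refine won_monic_of_pointBlowup p hp k 2 2 two_pos (![A₀, 0]) ?_ ?_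
  · intro j
    fin_cases j
    · simpa using hA₀
    · simp
  · intro c i₀ hc B hB hS
    have hch := CobordantChart.hasSubst_chart (fun _ : Fin 2 => 1) c (fun l hl => absurd hl one_ne_zero)
    -- `B 1 = 0`
    have hB1 : B 1 = 0 := by
      have h := hB 1
      simp only [Matrix.cons_val_one, Matrix.cons_val_zero, Fin.val_one] at h
      rw [← coe_substAlgHom hch, map_zero] at h
      exact (mul_eq_zero.mp h.symm).resolve_left (pow_ne_zero _ (FormalCoordChange.X_ne_zero' _))
    -- the successor `A₀'`
    have hB0 : subst (CobordantChart.chart (fun _ : Fin 2 => 1) c) A₀ = X 0 ^ 3 * B 0 := by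
      have h := hB 0
      simpa using h
    have hfac : subst (fun l : Fin 2 => if l = i₀ then C (c i₀) * X 0 else
        X 0 * (C (c l) + (X 1 : MvPowerSeries (Fin 2) k))) A₀ = X 0 ^ 2 * TupleGame.slice i₀ (X 0 * B 0) := by
      rw [← slice_subst_pointChart, hB0, MultiplicityLift.slice_X_zero_pow_mul, ← pow_one (X 0 : MvPowerSeries (Fin 3) k),
        MultiplicityLift.slice_X_zero_pow_mul]
      ring
    have hSeq : X (Fin.last 2) ^ 2 + ∑ j : Fin 2, rename (Fin.succAboveEmb (Fin.last 2))
        (TupleGame.slice i₀ (X 0 * B j)) * X (Fin.last 2) ^ (j : ℕ) =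
        X (Fin.last 2) ^ 2 + rename (Fin.succAboveEmb (Fin.last 2)) (TupleGame.slice i₀ (X 0 * B 0)) := by
      rw [Fin.sum_univ_two]
      simp only [Fin.val_zero, Fin.val_one, pow_zero, mul_one, hB1, mul_zero, slice_zero, map_zero, zero_mul, add_zero]
    rw [hSeq] at hS ⊢
    exact hsucc c i₀ hc _ hfac hS

/-! ### Characteristic `2`: cleaning by a square, and the cross-term exit -/

/-- RE-CENTRING BY A SQUARE keeps the INSEP class (characteristic `2`): `y² + (A₀ + φ²)` is won iff `y² + A₀` is
(`won_monic_two_recentre_iff` with `A₁ = 0`, `2φ = 0`). -/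
theorem won_dp_add_sq_iff [CharP k 2] (φ : MvPowerSeries (Fin 2) k) (hφ : constantCoeff φ = 0)
    (A₀ : MvPowerSeries (Fin 2) k) :
    CobordantGame.Won k 3 (X (Fin.last 2) ^ 2 + rename (Fin.succAboveEmb (Fin.last 2)) (A₀ + φ ^ 2)) ↔
      CobordantGame.Won k 3 (X (Fin.last 2) ^ 2 + rename (Fin.succAboveEmb (Fin.last 2)) A₀) := by
  have h := won_monic_two_recentre_iff (m := 2) φ hφ A₀ 0
  haveI : CharP (MvPowerSeries (Fin 2) k) 2 := charP_of_injective_algebraMap (C_injective (σ := Fin 2) (R := k)) 2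
  have h2 : (2 : MvPowerSeries (Fin 2) k) * φ = 0 := by
    rw [show (2 : MvPowerSeries (Fin 2) k) = 0 from CharTwo.two_eq_zero, zero_mul]
  simpa only [zero_mul, add_zero, zero_add, h2, map_zero] using h

/-- In characteristic `2` the square of a linear form has NO CROSS TERM. -/
theorem coeff_cross_sq_linear_eq_zero [CharP k 2] {N : ℕ} (ℓ : Fin N → k) {i j : Fin N} (hij : i ≠ j) :
    coeff (Finsupp.single i 1 + Finsupp.single j 1)
      ((∑ l, C (ℓ l) * X l : MvPowerSeries (Fin N) k) ^ 2) = 0 := by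
  rw [ConeDichotomy.sq_linear_eq_quadP, ConeDichotomy.coeff_pair_quadP, if_neg hij, Matrix.of_apply, Matrix.of_apply,
    mul_comm (ℓ j), CharTwo.add_self_eq_zero]

/-- THE CROSS-TERM EXIT (characteristic `2`, `k` algebraically closed): a singular `y² + A'` with `[x₀x₁] A' ≠ 0` is won from
the one-variable germs — its tangent quadric is not a square, so `stub_coneDichotomy` provides a hyperbolic pair for
`TangentConeCut.hyperbolicStartsWon`. -/
theorem won_dp_of_crossTerm [CharP k 2] [IsAlgClosed k]
    (hlow : ∀ g : MvPowerSeries (Fin 1) k, CobordantGame.IsSingular k g → CobordantGame.Won k 1 g)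
    (A' : MvPowerSeries (Fin 2) k)
    (hS : CobordantGame.IsSingular k (X (Fin.last 2) ^ 2 + rename (Fin.succAboveEmb (Fin.last 2)) A'))
    (h01 : coeff (Finsupp.single 0 1 + Finsupp.single 1 1) A' ≠ 0) :
    CobordantGame.Won k 3 (X (Fin.last 2) ^ 2 + rename (Fin.succAboveEmb (Fin.last 2)) A') := by
  rcases stub_coneDichotomy k 1 _ hS with hhyp | ⟨ℓ, hℓ⟩
  · exact TangentConeCut.hyperbolicStartsWon (n := 0) hlow _ hS hhyp
  · exfalso
    have h := hℓ 0 1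
    have hexp : (Finsupp.single (0 : Fin 3) 1 + Finsupp.single (1 : Fin 3) 1) =
        Finsupp.embDomain (Fin.succAboveEmb (Fin.last 2)) (Finsupp.single 0 1 + Finsupp.single 1 1) := by
      rw [Finsupp.embDomain_add, TerminalDoublePoint.embDomain_single, TerminalDoublePoint.embDomain_single]
      rfl
    rw [coeff_cross_sq_linear_eq_zero ℓ (by decide), hexp, TerminalDoublePoint.coeff_embDomain_dp] at h
    exact h01 h

/-- THE CLEANING RAISES THE ORDER (characteristic `2`): if `A'` has no terms of degree `≤ 1`, no cross term `x₀x₁`, and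
`α² = [x₀²]A'`, `β² = [x₁²]A'`, then `ord (A' + (αx₀ + βx₁)²) > 2`. -/
theorem two_lt_order_clean [CharP k 2] (A' : MvPowerSeries (Fin 2) k) (h0 : constantCoeff A' = 0)
    (h1 : ∀ l : Fin 2, coeff (Finsupp.single l 1) A' = 0) (h01 : coeff (Finsupp.single 0 1 + Finsupp.single 1 1) A' = 0)
    (α β : k) (hα : α ^ 2 = coeff (Finsupp.single 0 2) A') (hβ : β ^ 2 = coeff (Finsupp.single 1 2) A') :
    (2 : ℕ∞) < (A' + (C α * X 0 + C β * X 1) ^ 2).order := by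
  classical
  haveI : CharP (MvPowerSeries (Fin 2) k) 2 := charP_of_injective_algebraMap (C_injective (σ := Fin 2) (R := k)) 2
  have hsq : (C α * X 0 + C β * X 1 : MvPowerSeries (Fin 2) k) ^ 2 = C (α ^ 2) * X 0 ^ 2 + C (β ^ 2) * X 1 ^ 2 := by
    rw [CharTwo.add_sq, mul_pow, mul_pow, ← map_pow, ← map_pow]
  rw [hsq]
  suffices h3 : ((3 : ℕ) : ℕ∞) ≤ (A' + (C (α ^ 2) * X 0 ^ 2 + C (β ^ 2) * X 1 ^ 2)).order from
    lt_of_lt_of_le (by exact_mod_cast Nat.lt_succ_self 2) h3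
  refine nat_le_order fun d hd => ?_
  -- adapted from Literature.NumberTheory.EllipticCurves.finsupp_fin_two_eq (not imported: unrelated module)
  obtain ⟨d0, d1, rfl⟩ : ∃ d0 d1 : ℕ, d = Finsupp.single 0 d0 + Finsupp.single 1 d1 :=
    ⟨d 0, d 1, by ext i; fin_cases i <;> simp⟩
  rw [map_add, Finsupp.degree_single, Finsupp.degree_single] at hd
  have hd3 : d0 + d1 < 3 := by exact_mod_cast hd
  simp only [map_add, coeff_C_mul, coeff_X_pow]
  have hd0 : d0 ≤ 2 := by omega
  have hd1 : d1 ≤ 2 := by omega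
  interval_cases d0 <;> interval_cases d1
  · -- (0,0)
    simp only [Finsupp.single_zero, add_zero, coeff_zero_eq_constantCoeff_apply, h0]
    rw [if_neg (by intro h; have := congrArg (fun e => e 0) h; simp at this),
      if_neg (by intro h; have := congrArg (fun e => e 1) h; simp at this)]
    ring
  · -- (0,1)
    simp only [Finsupp.single_zero, zero_add, h1]
    rw [if_neg (by intro h; have := congrArg (fun e => e 0) h; simp at this),
      if_neg (by intro h; have := congrArg (fun e => e 1) h; simp at this)]
    ring
  · -- (0,2)
    simp only [Finsupp.single_zero, zero_add, ← hβ]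
    simp [Finsupp.single_eq_single_iff, CharTwo.add_self_eq_zero]
  · -- (1,0)
    simp only [Finsupp.single_zero, add_zero, h1]
    rw [if_neg (by intro h; have := congrArg (fun e => e 0) h; simp at this),
      if_neg (by intro h; have := congrArg (fun e => e 1) h; simp at this)]
    ring
  · -- (1,1)
    simp only [h01]
    rw [if_neg (by intro h; have := congrArg (fun e => e 1) h; simp at this),
      if_neg (by intro h; have := congrArg (fun e => e 0) h; simp at this)]
    ring
  · -- (1,2): degree 3, excluded
    omega
  · -- (2,0)
    simp only [Finsupp.single_zero, add_zero, ← hα]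
    simp [Finsupp.single_eq_single_iff, CharTwo.add_self_eq_zero]
  · omega
  · omega

/-- THE CLEANING DICHOTOMY (characteristic `2`, `k` algebraically closed): a SINGULAR `y² + A'` is won as soon as its cleaned
re-centring `y² + (A' + (αx₀ + βx₁)²)` — `α² = [x₀²]A'`, `β² = [x₁²]A'`, of order `> 2` in `A' + φ²` — is won; the cross-term
case exits by `won_dp_of_crossTerm`. -/
theorem won_dp_of_clean [CharP k 2] [IsAlgClosed k]
    (hlow : ∀ g : MvPowerSeries (Fin 1) k, CobordantGame.IsSingular k g → CobordantGame.Won k 1 g)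
    (A' : MvPowerSeries (Fin 2) k)
    (hS : CobordantGame.IsSingular k (X (Fin.last 2) ^ 2 + rename (Fin.succAboveEmb (Fin.last 2)) A'))
    (hclean : ∀ α β : k, α ^ 2 = coeff (Finsupp.single 0 2) A' → β ^ 2 = coeff (Finsupp.single 1 2) A' →
      (2 : ℕ∞) < (A' + (C α * X 0 + C β * X 1) ^ 2).order →
      CobordantGame.Won k 3 (X (Fin.last 2) ^ 2 + rename (Fin.succAboveEmb (Fin.last 2)) (A' + (C α * X 0 + C β * X 1) ^ 2))) :
    CobordantGame.Won k 3 (X (Fin.last 2) ^ 2 + rename (Fin.succAboveEmb (Fin.last 2)) A') := by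
  by_cases h01 : coeff (Finsupp.single 0 1 + Finsupp.single 1 1) A' = 0
  · obtain ⟨α, hα⟩ := IsAlgClosed.exists_pow_nat_eq (coeff (Finsupp.single 0 2) A') two_pos
    obtain ⟨β, hβ⟩ := IsAlgClosed.exists_pow_nat_eq (coeff (Finsupp.single 1 2) A') two_pos
    have h0 : constantCoeff A' = 0 := by
      have h := hS.2.1
      rw [← coeff_zero_eq_constantCoeff_apply, ← Finsupp.embDomain_zero (f := Fin.succAboveEmb (Fin.last 2)),
        TerminalDoublePoint.coeff_embDomain_dp, coeff_zero_eq_constantCoeff_apply] at h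
      exact h
    have h1 := TerminalDoublePoint.coeff_single_one_eq_zero_of_isSingular hS
    have hord := two_lt_order_clean A' h0 h1 h01 α β hα hβ
    have hφ : constantCoeff (C α * X 0 + C β * X 1 : MvPowerSeries (Fin 2) k) = 0 := by
      simp [constantCoeff_X]
    exact (won_dp_add_sq_iff _ hφ A').mp (hclean α β hα hβ hord)
  · exact won_dp_of_crossTerm hlow A' hS h01

end InsepDoublePoint

open InsepDoublePoint TerminalDoublePoint MvPowerSeries in
/-- THE INSEP POINT STEP WITH CLEANING (characteristic `2`, `k` algebraically closed; only the one-variable singular germs are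
assumed won).  `y² + A₀(x₀,x₁)` with `ord A₀ > 2` is won as soon as, for every direction `c` of the point blow-up, live slot
`i₀` (`c_{i₀} ≠ 0`), successor `A₀'` (`A₀(π_{i₀,c}) = x₀² · A₀'`) and square roots `α² = [x₀²]A₀'`, `β² = [x₁²]A₀'`, the CLEANED
successor `y² + (A₀' + (αx₀ + βx₁)²)` is won whenever it is again in the class (`ord > 2`).  Every other successor exits
(non-singular, or hyperbolic by the cross term). [OURS · L1 W4.3, unit (u2) of CRUX-PLAN v2] -/
theorem won_insep_of_pointStep (k : Type) [Field k] [CharP k 2] [IsAlgClosed k]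
    (hlow : ∀ g : MvPowerSeries (Fin 1) k, CobordantGame.IsSingular k g → CobordantGame.Won k 1 g)
    (A₀ : MvPowerSeries (Fin 2) k) (hA₀ : (2 : ℕ∞) < A₀.order)
    (hsucc : ∀ (c : Fin 2 → k) (i₀ : Fin 2), c i₀ ≠ 0 → ∀ (A₀' : MvPowerSeries (Fin 2) k) (α β : k),
      MvPowerSeries.subst (fun l : Fin 2 => if l = i₀ then MvPowerSeries.C (c i₀) * MvPowerSeries.X 0 else
        MvPowerSeries.X 0 * (MvPowerSeries.C (c l) + (MvPowerSeries.X 1 : MvPowerSeries (Fin 2) k))) A₀ =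
        MvPowerSeries.X 0 ^ 2 * A₀' →
      α ^ 2 = MvPowerSeries.coeff (Finsupp.single 0 2) A₀' → β ^ 2 = MvPowerSeries.coeff (Finsupp.single 1 2) A₀' →
      (2 : ℕ∞) < (A₀' + (MvPowerSeries.C α * MvPowerSeries.X 0 + MvPowerSeries.C β * MvPowerSeries.X 1) ^ 2).order →
      CobordantGame.Won k 3 (MvPowerSeries.X (Fin.last 2) ^ 2 + MvPowerSeries.rename (Fin.succAboveEmb (Fin.last 2))
        (A₀' + (MvPowerSeries.C α * MvPowerSeries.X 0 + MvPowerSeries.C β * MvPowerSeries.X 1) ^ 2))) :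
    CobordantGame.Won k 3 (MvPowerSeries.X (Fin.last 2) ^ 2 + MvPowerSeries.rename (Fin.succAboveEmb (Fin.last 2)) A₀) :=
  won_dp_of_pointStep 2 Nat.prime_two k A₀ hA₀ fun c i₀ hc A₀' hfac hS =>
    won_dp_of_clean hlow A₀' hS fun α β hα hβ hord => hsucc c i₀ hc A₀' α β hfac hα hβ hord

open InsepDoublePoint TerminalDoublePoint MvPowerSeries in
/-- THE INSEP CURVE STEP WITH CLEANING (characteristic `2`, `k` algebraically closed).  If `A₀ = x_i² · A₀'` with `A₀'(0) = 0`,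
then `y² + A₀` is won as soon as, for every `c ≠ 0`, the CLEANED successor `y² + (A' + (αx₀ + βx₁)²)` of the blow-up of
`V(x_i, y)` — `A' = c² · A₀'(ρ_{i,c})`, `ρ_{i,c} : x_i ↦ c x₀, x_{1-i} ↦ x₁`, `α² = [x₀²]A'`, `β² = [x₁²]A'` — is won whenever it
is again in the class (`ord > 2`). [OURS · L1 W4.3, unit (u2)/(u4) of CRUX-PLAN v2] -/
theorem won_insep_of_curveStep (k : Type) [Field k] [CharP k 2] [IsAlgClosed k]
    (hlow : ∀ g : MvPowerSeries (Fin 1) k, CobordantGame.IsSingular k g → CobordantGame.Won k 1 g)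
    (i : Fin 2) (A₀ A₀' : MvPowerSeries (Fin 2) k) (hdiv : A₀ = MvPowerSeries.X i ^ 2 * A₀')
    (h0 : MvPowerSeries.constantCoeff A₀' = 0)
    (hsucc : ∀ c : k, c ≠ 0 → ∀ (A' : MvPowerSeries (Fin 2) k) (α β : k),
      A' = MvPowerSeries.C (c ^ 2) * MvPowerSeries.subst (fun l : Fin 2 => if l = i then
        MvPowerSeries.C c * MvPowerSeries.X 0 else (MvPowerSeries.X 1 : MvPowerSeries (Fin 2) k)) A₀' →
      α ^ 2 = MvPowerSeries.coeff (Finsupp.single 0 2) A' → β ^ 2 = MvPowerSeries.coeff (Finsupp.single 1 2) A' →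
      (2 : ℕ∞) < (A' + (MvPowerSeries.C α * MvPowerSeries.X 0 + MvPowerSeries.C β * MvPowerSeries.X 1) ^ 2).order →
      CobordantGame.Won k 3 (MvPowerSeries.X (Fin.last 2) ^ 2 + MvPowerSeries.rename (Fin.succAboveEmb (Fin.last 2))
        (A' + (MvPowerSeries.C α * MvPowerSeries.X 0 + MvPowerSeries.C β * MvPowerSeries.X 1) ^ 2))) :
    CobordantGame.Won k 3 (MvPowerSeries.X (Fin.last 2) ^ 2 + MvPowerSeries.rename (Fin.succAboveEmb (Fin.last 2)) A₀) :=
  won_dp_of_curveStep 2 Nat.prime_two k i A₀ A₀' hdiv h0 fun c hc hS =>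
    won_dp_of_clean hlow _ hS fun α β hα hβ hord => hsucc c hc _ α β rfl hα hβ hord

end Summit.ResolutionOfSingularities.ResolutionOfSingularities.Theorems
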